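import Literature.RingTheory.GradedAlgebra.ProjFlatOfFlatPieces
import Mathlib.AlgebraicGeometry.ProjectiveSpectrum.Proper
import Mathlib.AlgebraicGeometry.Morphisms.Flat
import HarnessLib

/-!
# `Proj A → Spec R` is flat when the graded pieces of `A` are eventually flat
# (Hartshorne III.9.9, (ii) ⇒ (i))

Scheme-level form of `Literature.RingTheory.GradedAlgebra.flat_away_of_flat_pieces`: for a
graded `R`-algebra `A = ⊕ 𝒜 n`, finitely generated over `𝒜 0`, whose graded pieces `𝒜 n` are
flat `R`-modules for all `n ≥ k`, the structure morphism `Proj A → Spec (𝒜 0) → Spec R` is flat.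
Proof as printed (Hartshorne III.9.9, (ii) ⇒ (i): "`𝓕 = M̃` […] Since `M` is […] flat […] `𝓕` is
flat"): flatness is local on the source, `Proj A` is covered by the `D₊(f) = Spec A_{(f)}`,
`f` homogeneous of positive degree among a finite set of generators (Mathlib
`Proj.iSup_basicOpen_eq_top'`), and each `R → A_{(f)}` is flat by the ring-level statement.

* `flat_toSpecZero_comp_of_flat_pieces` — the theorem.

Brick (4) of the flattening road `lit/res-lit-4/gen21/FLATTENING-ROADMAP.md` §5.3 (cell
`res-hironaka`), in the form consumed there: `C = (B ⊗ R')/torsion` with `C_n` flat for `n ≥ k`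
gives `Proj C → Spec R'` flat.

## References

* [Hartshorne1977] R. Hartshorne, *Algebraic Geometry*, GTM 52 (1977), III, Thm. 9.9, proof of
  (ii) ⇒ (i), p. 262.
-/

noncomputable section

universe u

open AlgebraicGeometry CategoryTheory HomogeneousLocalization

namespace Literature.AlgebraicGeometry.Morphisms

variable {R A : Type u} [CommRing R] [CommRing A] [Algebra R A]
  (𝒜 : ℕ → Submodule R A) [GradedAlgebra 𝒜]

/-- **Hartshorne III.9.9, (ii) ⇒ (i), for schemes**: if `A = ⊕ 𝒜 n` is a graded `R`-algebra,
finitely generated over `𝒜 0`, with `𝒜 n` flat over `R` for all `n ≥ k`, then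
`Proj A → Spec R` is flat. [cite: Hartshorne1977, III Thm. 9.9, proof of (ii) ⇒ (i), p. 262] -/
theorem flat_toSpecZero_comp_of_flat_pieces [Algebra.FiniteType (𝒜 0) A] {k : ℕ}
    (hflat : ∀ n, k ≤ n → Module.Flat R (𝒜 n)) :
    Flat (Proj.toSpecZero 𝒜 ≫ Spec.map (CommRingCat.ofHom (algebraMap R (𝒜 0)))) := by
  obtain ⟨x, hx, hx'⟩ := GradedAlgebra.exists_finset_adjoin_eq_top_and_homogeneous_ne_zero 𝒜
  choose d hd hxd using hx'
  rw [IsZariskiLocalAtSource.iff_of_iSup_eq_top (P := @Flat) _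
    (Proj.iSup_basicOpen_eq_top' 𝒜 (ι := x) (↑) (fun i ↦ ⟨_, hxd _ i.2⟩) (by simpa using hx))]
  intro i
  rw [← MorphismProperty.cancel_left_of_respectsIso (P := @Flat)
    (Proj.basicOpenIsoSpec 𝒜 (i : A) (hxd _ i.2) (hd _ i.2).bot_lt).inv, ← Category.assoc,
    ← Category.assoc, ← Proj.awayι, Proj.awayι_toSpecZero, ← Spec.map_comp,
    ← CommRingCat.ofHom_comp, HasRingHomProperty.Spec_iff (P := @Flat)]
  exact Literature.RingTheory.GradedAlgebra.flat_away_of_flat_pieces 𝒜 (hxd _ i.2)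
    (hd _ i.2).bot_lt hflat

end Literature.AlgebraicGeometry.Morphisms

end
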